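import Summits.ValiantsHypothesis.ValiantsHypothesis.Theorems.RigidityForcesSymmetryGrenetFirstOrderRankRigidBlockIIExtraPrelim

/-!
# Route RigidityForcesSymmetry — `GrenetFirstOrderRankRigid` (item stmt-ValiantsHypothesis-21029),
line `grenet_gauge`: stub `stub_linearRigid`, step 5 (block II, design E3) — the block terms at the
right-anchored extra-cell point

For the crux line `Cruxes/GrenetFirstOrderRankRigid/Lines/grenet_gauge.lean` (blueprint
`Lines/grenet_gauge-stub_linearRigid-PROOF.md`, §5, block II; NOTES "TYPE II FORMAL PLAN").
Design E3 of the overlap block `(A, k₀)` (`u = |A| + k₀ < n`), for `C ⊆ Aᶜ` with `|C| = k₀`,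
`φ' ∉ A ∪ C` and `α₁ ∈ A`: the 0/1 point of a permutation `π` with `π({c < k₀}) = C`,
`π({c < k₀+1}) = C + φ'`, `π({c < u}) = (C + φ') ∪ (A - α₁)`, `π(k₀) = φ'`, `π(u) = α₁`, together with
the extra cell `x_{α₁, k₀} = 1`.  At this point the cofactor term of

a tail entry `ρ[T, p]` evaluates to `[p = αₐ] - [p = αₐ ∧ T = C]` (`αₐ = π(u-1)` if `|A| ≥ 2`,
`αₐ = α₁` if `|A| = 1`; `blockII_extraB_eval_tail`), and of a head entry `κ[C', p]` to
`[p = α₁] - [C' = C ∧ p = φ']` (`blockII_extraB_eval_head`).  No definitions; VP ≠ VNP is not moved.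
-/

noncomputable section

open MvPolynomial Matrix Finset

namespace Summit.ValiantsHypothesis.Theorems.RigidityForcesSymmetry.GrenetGauge

open Literature.Computability.AlgebraicComplexity

section Extra

variable (k : Type*) [CommRing k] {n : ℕ}

/-- **E3, tail entries.**  At the right-anchored extra-cell point of the block `(A, k₀)` (see the
file header), the cofactor term of a tail entry `ρ[T, p]` (`S + p = A ⊔ T`, `v = (p, u-1)`)
evaluates to `[p = αₐ] - [p = αₐ ∧ T = C]` (`αₐ = π(u-1)` if `|A| ≥ 2`, `αₐ = α₁` if `|A| = 1`).
[cite: Grenet2011, Thm. 1] -/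
theorem blockII_extraB_eval_tail (π : Equiv.Perm (Fin n)) (A C : Finset (Fin n)) (k₀ : ℕ) {u : ℕ}
    (huA : A.card + k₀ = u) (hul : u - 1 < n) (hkn : k₀ < n) (hun : u < n) (hCA : C ⊆ Aᶜ)
    (φ' α₁ : Fin n) (hφ'A : φ' ∉ A) (hφ'C : φ' ∉ C) (hα₁ : α₁ ∈ A)
    (hπk : π ⟨k₀, hkn⟩ = φ') (hπu : π ⟨u, hun⟩ = α₁)
    (ht1 : (univ.filter fun c : Fin n => (c : ℕ) < k₀).image π = C)
    (ht2 : (univ.filter fun c : Fin n => (c : ℕ) < k₀ + 1).image π = insert φ' C)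
    (ht3 : (univ.filter fun c : Fin n => (c : ℕ) < u).image π = insert φ' (C ∪ A.erase α₁))
    (S T : Finset (Fin n)) (v : Fin n × Fin n) (ht : v.1 ∉ S ∧ (v.2 : ℕ) = S.card) (hTsub : T ⊆ Aᶜ)
    (hTk : T.card = k₀) (hUS : insert v.1 S = A ∪ T) (hq : (v.2 : ℕ) = u - 1)
    (αₐ : Fin n) (hαₐ : k₀ < u - 1 → αₐ = π ⟨u - 1, hul⟩) (hαₐ' : u - 1 = k₀ → αₐ = α₁) :
    eval (fun w : Fin n × Fin n => if π w.2 = w.1 ∨ (w.2 = (⟨k₀, hkn⟩ : Fin n) ∧ w.1 = π ⟨u, hun⟩) then (1 : k) else 0) (perPoly (Fin n) k * (1 - Grenet.adj k n).adjugate T S * X v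
          - (1 - Grenet.adj k n).adjugate ∅ S * X v * (1 - Grenet.adj k n).adjugate T univ)
      = (if v.1 = αₐ then 1 else 0) - (if v.1 = αₐ ∧ T = C then 1 else 0) := by
  have hdisjT : Disjoint A T := Finset.disjoint_left.mpr fun x hxA hxT => (Finset.mem_compl.mp (hTsub hxT)) hxA
  have hdisjC : Disjoint A C := Finset.disjoint_left.mpr fun x hxA hxC => (Finset.mem_compl.mp (hCA hxC)) hxA
  have hScard : S.card = u - 1 := by rw [← ht.2, hq]
  have hSeq : S = (A ∪ T).erase v.1 := by rw [← hUS, Finset.erase_insert ht.1]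
  have hv2 : v.2 = ⟨u - 1, hul⟩ := Fin.ext hq
  have hvAT : v.1 ∈ A ∪ T := by rw [← hUS]; exact Finset.mem_insert_self _ _
  have hα₁C : α₁ ∉ C := fun h => Finset.disjoint_left.mp hdisjC hα₁ h
  have hα₁T : α₁ ∉ T := fun h => Finset.disjoint_left.mp hdisjT hα₁ h
  have hφ'α : φ' ≠ α₁ := fun h => hφ'A (h ▸ hα₁)
  have hA : 0 < A.card := Finset.card_pos.mpr ⟨α₁, hα₁⟩
  have hu1 : 0 < u := by omega
  have hc01 : (⟨k₀, hkn⟩ : Fin n) ≠ ⟨u, hun⟩ := Fin.ne_of_val_ne (show k₀ ≠ u by omega)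
  have hSdT : S \ T = A.erase v.1 := by rw [hSeq]; exact erase_union_sdiff_of_disjoint hdisjT _
  have hTS : ∀ β ∈ A, v.1 = β → T ⊆ S := fun β hβ hp x hx => by
    rw [hSeq]
    exact Finset.mem_erase.mpr ⟨fun h => Finset.disjoint_left.mp hdisjT hβ (hp ▸ h ▸ hx), Finset.mem_union_right _ hx⟩
  -- the letter `αₐ` and the data of the two cases
  have hαₐA : αₐ ∈ A ∧ (k₀ < u - 1 → αₐ ≠ α₁) := by
    rcases Nat.lt_or_ge k₀ (u - 1) with hlt | hge
    · have heq := hαₐ hlt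
      have : π ⟨u - 1, hul⟩ ∈ (univ.filter fun c : Fin n => k₀ + 1 ≤ (c : ℕ) ∧ (c : ℕ) < u).image π := by
        rw [mem_permSlice, Equiv.symm_apply_apply]; simp only; omega
      rw [permSlice_eq_sdiff π (by omega), ht3, ht2, ← heq, Finset.mem_sdiff, Finset.mem_insert,
        Finset.mem_union, Finset.mem_insert, not_or] at this
      obtain ⟨h1, hnφ, hnC⟩ := this
      rcases h1 with h1 | h1 | h1
      · exact absurd h1 hnφ
      · exact absurd h1 hnC
      · exact ⟨Finset.mem_of_mem_erase h1, fun _ => Finset.ne_of_mem_erase h1⟩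
    · exact ⟨(hαₐ' (by omega)).symm ▸ hα₁, fun h => absurd h (by omega)⟩
  have hαₐT : αₐ ∉ T := fun h => Finset.disjoint_left.mp hdisjT hαₐA.1 h
  -- the evaluations
  have eX1 : v.1 = αₐ → eval (fun w : Fin n × Fin n => if π w.2 = w.1 ∨ (w.2 = (⟨k₀, hkn⟩ : Fin n) ∧ w.1 = π ⟨u, hun⟩) then (1 : k) else 0) (X v) = 1 := fun hp => by
    rw [eval_X, hv2, if_pos]
    rcases Nat.lt_or_ge k₀ (u - 1) with hlt | hge
    · exact Or.inl (by rw [hp, hαₐ hlt])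
    · exact Or.inr ⟨Fin.ext (show u - 1 = k₀ by omega), by rw [hp, hαₐ' (by omega), hπu]⟩
  have eTS : eval (fun w : Fin n × Fin n => if π w.2 = w.1 ∨ (w.2 = (⟨k₀, hkn⟩ : Fin n) ∧ w.1 = π ⟨u, hun⟩) then (1 : k) else 0) ((1 - Grenet.adj k n).adjugate T S) = if v.1 = αₐ then 1 else 0 := by
    have harith : ¬ (k₀ ≤ u ∧ u < u - 1) := fun h => by omega
    rw [evalPermExtra_grenet_W k π ⟨k₀, hkn⟩ ⟨u, hun⟩ hc01 T S (by rw [hTk, hScard]; omega), hTk, hScard]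
    rcases Nat.lt_or_ge k₀ (u - 1) with hlt | hge
    · -- `|A| ≥ 2`
      have heq := hαₐ hlt
      have hne := hαₐA.2 hlt
      have hPu1 : (univ.filter fun c : Fin n => (c : ℕ) < u - 1).image π
          = (insert φ' (C ∪ A.erase α₁)).erase αₐ := by
        have h := Grenet.prefix_image_succ π hul
        simp only [Nat.sub_add_cancel hu1] at h
        rw [ht3, ← heq] at h
        have hnm : αₐ ∉ (univ.filter fun c : Fin n => (c : ℕ) < u - 1).image π := by
          rw [heq, Grenet.mem_prefix_image, Equiv.symm_apply_apply]; exact lt_irrefl _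
        rw [← Finset.erase_insert hnm, ← h]
      have hZ : (univ.filter fun c : Fin n => k₀ ≤ (c : ℕ) ∧ (c : ℕ) < u - 1).image π
          = ((insert φ' (C ∪ A.erase α₁)).erase αₐ) \ C := by
        rw [permSlice_eq_sdiff π (by omega), hPu1, ht1]
      have hφ'Z : φ' ∈ ((insert φ' (C ∪ A.erase α₁)).erase αₐ) \ C :=
        Finset.mem_sdiff.mpr ⟨Finset.mem_erase.mpr ⟨fun h => hφ'A (h ▸ hαₐA.1), Finset.mem_insert_self _ _⟩, hφ'C⟩
      have n1 : ¬ (T ⊆ S ∧ A.erase v.1 = ((insert φ' (C ∪ A.erase α₁)).erase αₐ) \ C) := fun h =>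
        hφ'A (Finset.mem_of_mem_erase (h.2.symm ▸ hφ'Z))
      have hZ' : insert α₁ ((((insert φ' (C ∪ A.erase α₁)).erase αₐ) \ C).erase φ') = A.erase αₐ := by
        ext x
        simp only [Finset.mem_insert, Finset.mem_erase, Finset.mem_sdiff, Finset.mem_union, ne_eq]
        constructor
        · rintro (rfl | ⟨hxφ, ⟨hxα, rfl | hxC | ⟨hx1, hxA⟩⟩, hnC⟩)
          · exact ⟨hne.symm, hα₁⟩
          · exact absurd rfl hxφ
          · exact absurd hxC hnC
          · exact ⟨hxα, hxA⟩
        · rintro ⟨hxα, hxA⟩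
          by_cases hx1 : x = α₁
          · exact Or.inl hx1
          · exact Or.inr ⟨fun h => hφ'A (h ▸ hxA), ⟨hxα, Or.inr (Or.inr ⟨hx1, hxA⟩)⟩,
              fun h => Finset.disjoint_left.mp hdisjC hxA h⟩
      rw [hZ]
      simp only [disjoint_and_union_eq_iff, hSdT, hπu, hπk, hZ']
      rw [if_neg n1, zero_add]
      by_cases hp : v.1 = αₐ
      · rw [if_pos hp, if_pos]
        exact ⟨le_rfl, hlt, harith, hTS αₐ hαₐA.1 hp, by rw [hp]⟩
      · rw [if_neg hp, if_neg]
        rintro ⟨-, -, -, -, h⟩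
        exact hp (((Finset.erase_inj A hαₐA.1).mp h.symm).symm)
    · -- `|A| = 1`
      have heq := hαₐ' (by omega)
      have hZ : (univ.filter fun c : Fin n => k₀ ≤ (c : ℕ) ∧ (c : ℕ) < u - 1).image π = ∅ := by
        ext x; rw [mem_permSlice]; simp only [Finset.notMem_empty, iff_false]; omega
      rw [hZ]
      simp only [disjoint_and_union_eq_iff, hSdT, hπu, hπk]
      have hAone : A = {α₁} := by
        obtain ⟨a, ha⟩ := Finset.card_eq_one.mp (show A.card = 1 by omega)
        rw [ha] at hα₁ ⊢; rw [Finset.mem_singleton.mp hα₁]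
      have n2 : ¬ (k₀ ≤ k₀ ∧ k₀ < u - 1 ∧ ¬ (k₀ ≤ u ∧ u < u - 1) ∧ T ⊆ S ∧
          A.erase v.1 = insert α₁ ((∅ : Finset (Fin n)).erase φ')) := fun h => by
        have := h.2.1; omega
      rw [if_neg n2, add_zero]
      by_cases hp : v.1 = αₐ
      · rw [if_pos hp, if_pos]
        refine ⟨hTS αₐ hαₐA.1 hp, ?_⟩
        rw [hp, heq, hAone, Finset.erase_singleton]
      · rw [if_neg hp, if_neg]
        rintro ⟨-, h2⟩
        rw [hAone, Finset.erase_eq_empty_iff, Finset.singleton_inj] at h2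
        rcases h2 with h2 | h2
        · exact absurd h2 (Finset.singleton_ne_empty _)
        · exact hp (h2.symm.trans heq.symm)
  have e0S : eval (fun w : Fin n × Fin n => if π w.2 = w.1 ∨ (w.2 = (⟨k₀, hkn⟩ : Fin n) ∧ w.1 = π ⟨u, hun⟩) then (1 : k) else 0) ((1 - Grenet.adj k n).adjugate ∅ S) = if (v.1 = αₐ ∧ T = C) then 1 else 0 := by
    rw [evalPermExtra_grenet_W k π ⟨k₀, hkn⟩ ⟨u, hun⟩ hc01 ∅ S (by simp), Finset.card_empty, hScard,
      permSlice_zero, hπu, hπk]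
    simp only [Finset.disjoint_empty_left, true_and, Finset.empty_union]
    -- `S = (A ∪ T) - p` equals `C ∪ (A - αₐ)` iff `p = αₐ ∧ T = C`
    have key : S = C ∪ A.erase αₐ ↔ (v.1 = αₐ ∧ T = C) := by
      constructor
      · intro h
        have hpa : v.1 = αₐ := by
          by_contra hne
          have : αₐ ∈ S := by
            rw [hSeq]; exact Finset.mem_erase.mpr ⟨fun h' => hne h'.symm, Finset.mem_union_left _ hαₐA.1⟩
          rw [h, Finset.mem_union] at this
          exact this.elim (fun h' => Finset.disjoint_left.mp hdisjC hαₐA.1 h') (fun h' => Finset.ne_of_mem_erase h' rfl)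
        refine ⟨hpa, ?_⟩
        have h' : A.erase αₐ ∪ T = A.erase αₐ ∪ C := by
          rw [Finset.union_comm _ C, ← h, hSeq, hpa]
          ext x
          simp only [Finset.mem_union, Finset.mem_erase, ne_eq]
          constructor
          · rintro (⟨hne, hxA⟩ | hxT)
            · exact ⟨hne, Or.inl hxA⟩
            · exact ⟨fun h => hαₐT (h ▸ hxT), Or.inr hxT⟩
          · rintro ⟨hne, hxA | hxT⟩
            · exact Or.inl ⟨hne, hxA⟩
            · exact Or.inr hxT
        exact (union_eq_union_iff_of_disjoint
          (Finset.disjoint_of_subset_left (Finset.erase_subset _ _) hdisjT)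
          (Finset.disjoint_of_subset_left (Finset.erase_subset _ _) hdisjC)).mp h'
      · rintro ⟨hpa, rfl⟩
        rw [hSeq, hpa, Finset.union_comm]
        ext x
        simp only [Finset.mem_union, Finset.mem_erase, ne_eq]
        constructor
        · rintro ⟨hne, hxT | hxA⟩
          · exact Or.inl hxT
          · exact Or.inr ⟨hne, hxA⟩
        · rintro (hxT | ⟨hne, hxA⟩)
          · exact ⟨fun h => hαₐT (h ▸ hxT), Or.inl hxT⟩
          · exact ⟨hne, Or.inr hxA⟩
    rcases Nat.lt_or_ge k₀ (u - 1) with hlt | hge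
    · -- `|A| ≥ 2`
      have heq := hαₐ hlt
      have hne := hαₐA.2 hlt
      have hPu1 : (univ.filter fun c : Fin n => (c : ℕ) < u - 1).image π
          = (insert φ' (C ∪ A.erase α₁)).erase αₐ := by
        have h := Grenet.prefix_image_succ π hul
        simp only [Nat.sub_add_cancel hu1] at h
        rw [ht3, ← heq] at h
        have hnm : αₐ ∉ (univ.filter fun c : Fin n => (c : ℕ) < u - 1).image π := by
          rw [heq, Grenet.mem_prefix_image, Equiv.symm_apply_apply]; exact lt_irrefl _
        rw [← Finset.erase_insert hnm, ← h]
      rw [hPu1]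
      -- cond1 is impossible: one of `α₁`, `αₐ` lies in `S` but not in the prefix
      have n1 : ¬ ((insert φ' (C ∪ A.erase α₁)).erase αₐ = S) := fun h => by
        by_cases hp1 : v.1 = α₁
        · have : αₐ ∈ S := by
            rw [hSeq, hp1]; exact Finset.mem_erase.mpr ⟨hne, Finset.mem_union_left _ hαₐA.1⟩
          rw [← h] at this
          exact Finset.notMem_erase _ _ this
        · have : α₁ ∈ S := by
            rw [hSeq]; exact Finset.mem_erase.mpr ⟨fun h' => hp1 h'.symm, Finset.mem_union_left _ hα₁⟩
          rw [← h, Finset.mem_erase, Finset.mem_insert, Finset.mem_union] at this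
          rcases this.2 with h' | h' | h'
          · exact hφ'α h'.symm
          · exact hα₁C h'
          · exact Finset.notMem_erase _ _ h'
      have hQ : insert α₁ (((insert φ' (C ∪ A.erase α₁)).erase αₐ).erase φ') = C ∪ A.erase αₐ := by
        ext x
        simp only [Finset.mem_insert, Finset.mem_erase, Finset.mem_union, ne_eq]
        constructor
        · rintro (rfl | ⟨hxφ, hxα, rfl | hxC | ⟨hx1, hxA⟩⟩)
          · exact Or.inr ⟨hne.symm, hα₁⟩
          · exact absurd rfl hxφ
          · exact Or.inl hxC
          · exact Or.inr ⟨hxα, hxA⟩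
        · rintro (hxC | ⟨hxα, hxA⟩)
          · exact Or.inr ⟨fun h => hφ'C (h ▸ hxC), fun h => Finset.disjoint_left.mp hdisjC hαₐA.1 (h ▸ hxC),
              Or.inr (Or.inl hxC)⟩
          · by_cases hx1 : x = α₁
            · exact Or.inl hx1
            · exact Or.inr ⟨fun h => hφ'A (h ▸ hxA), hxα, Or.inr (Or.inr ⟨hx1, hxA⟩)⟩
      rw [hQ, if_neg n1, zero_add]
      by_cases hp : v.1 = αₐ ∧ T = C
      · rw [if_pos hp, if_pos]
        exact ⟨Nat.zero_le _, hlt, fun h => by omega, (key.mpr hp).symm⟩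
      · rw [if_neg hp, if_neg (fun h => hp (key.mp h.2.2.2.symm))]
    · -- `|A| = 1`
      have heq := hαₐ' (by omega)
      have hk : u - 1 = k₀ := by omega
      simp only [hk, ht1]
      have hAe : A.erase αₐ = ∅ := by
        obtain ⟨a, ha⟩ := Finset.card_eq_one.mp (show A.card = 1 by omega)
        rw [ha] at hα₁ ⊢; rw [heq, Finset.mem_singleton.mp hα₁, Finset.erase_singleton]
      rw [hAe, Finset.union_empty] at key
      have n2 : ¬ (0 ≤ k₀ ∧ k₀ < k₀ ∧ ¬ (0 ≤ u ∧ u < k₀) ∧ insert α₁ (C.erase φ') = S) := fun h => by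
        have := h.2.1; omega
      rw [if_neg n2, add_zero]
      by_cases hp : v.1 = αₐ ∧ T = C
      · rw [if_pos hp, if_pos (key.mpr hp).symm]
      · rw [if_neg hp, if_neg (fun h => hp (key.mp h.symm))]
  have eTU : eval (fun w : Fin n × Fin n => if π w.2 = w.1 ∨ (w.2 = (⟨k₀, hkn⟩ : Fin n) ∧ w.1 = π ⟨u, hun⟩) then (1 : k) else 0) ((1 - Grenet.adj k n).adjugate T univ) = if T = C then 1 else 0 := by
    rw [evalPermExtra_grenet_W k π ⟨k₀, hkn⟩ ⟨u, hun⟩ hc01 T univ (by rw [Finset.card_univ]; exact Finset.card_le_univ T),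
      hTk, Finset.card_univ, Fintype.card_fin, permSlice_to_top, ht1]
    have n2 : ¬ (k₀ ≤ k₀ ∧ k₀ < n ∧ ¬ (k₀ ≤ u ∧ u < n) ∧
        Disjoint T (insert α₁ ((Cᶜ).erase φ')) ∧ T ∪ insert α₁ ((Cᶜ).erase φ') = univ) := fun h => by
      have := h.2.2.1; omega
    simp only [hπu, hπk]
    rw [if_neg n2, add_zero]
    simp only [disjoint_compl_and_union_iff]
  rw [map_sub, map_mul, map_mul, map_mul, map_mul, evalExtra_perPoly k π _ _ hc01, eTS, e0S, eTU]
  by_cases hp : v.1 = αₐ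
  · rw [eX1 hp, if_pos hp]
    by_cases hC : T = C
    · rw [if_pos hC, if_pos ⟨hp, hC⟩]; ring
    · rw [if_neg hC, if_neg (fun h => hC h.2)]; ring
  · rw [if_neg hp, if_neg (fun h => hp h.1)]; ring

/-- **E3, head entries.**  At the right-anchored extra-cell point of the block `(A, k₀)`, the
cofactor term of a head entry `κ[C', p]` (`S = A ⊔ C'`, `T = C' + p`, `v = (p, k₀)`) evaluates to
`[p = α₁] - [C' = C ∧ p = φ']`. [cite: Grenet2011, Thm. 1] -/
theorem blockII_extraB_eval_head (π : Equiv.Perm (Fin n)) (A C : Finset (Fin n)) (k₀ : ℕ) {u : ℕ}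
    (huA : A.card + k₀ = u) (hkn : k₀ < n) (hun : u < n) (hCA : C ⊆ Aᶜ)
    (φ' α₁ : Fin n) (hφ'A : φ' ∉ A) (hφ'C : φ' ∉ C) (hα₁ : α₁ ∈ A)
    (hπk : π ⟨k₀, hkn⟩ = φ') (hπu : π ⟨u, hun⟩ = α₁)
    (ht2 : (univ.filter fun c : Fin n => (c : ℕ) < k₀ + 1).image π = insert φ' C)
    (ht3 : (univ.filter fun c : Fin n => (c : ℕ) < u).image π = insert φ' (C ∪ A.erase α₁))
    (S T : Finset (Fin n)) (v : Fin n × Fin n) (hh : v.1 ∈ T ∧ T.card = (v.2 : ℕ) + 1)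
    (hCsub : T.erase v.1 ⊆ Aᶜ) (hCk' : (T.erase v.1).card = k₀) (hS : S = A ∪ T.erase v.1)
    (hq : (v.2 : ℕ) = k₀) :
    eval (fun w : Fin n × Fin n => if π w.2 = w.1 ∨ (w.2 = (⟨k₀, hkn⟩ : Fin n) ∧ w.1 = π ⟨u, hun⟩) then (1 : k) else 0) (perPoly (Fin n) k * (1 - Grenet.adj k n).adjugate T S * X v
          - (1 - Grenet.adj k n).adjugate ∅ S * X v * (1 - Grenet.adj k n).adjugate T univ)
      = (if v.1 = α₁ then 1 else 0) - (if T.erase v.1 = C ∧ v.1 = φ' then 1 else 0) := by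
  have hdisjC' : Disjoint A (T.erase v.1) :=
    Finset.disjoint_left.mpr fun x hxA hx => (Finset.mem_compl.mp (hCsub hx)) hxA
  have hdisjC : Disjoint A C := Finset.disjoint_left.mpr fun x hxA hxC => (Finset.mem_compl.mp (hCA hxC)) hxA
  have hpC' : v.1 ∉ T.erase v.1 := Finset.notMem_erase _ _
  have hTcard : T.card = k₀ + 1 := by rw [hh.2, hq]
  have hScard : S.card = u := by rw [hS, Finset.card_union_of_disjoint hdisjC', hCk', huA]
  have hv2 : v.2 = ⟨k₀, hkn⟩ := Fin.ext hq
  have hα₁C : α₁ ∉ C := fun h => Finset.disjoint_left.mp hdisjC hα₁ h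
  have hφ'α : φ' ≠ α₁ := fun h => hφ'A (h ▸ hα₁)
  have hA : 0 < A.card := Finset.card_pos.mpr ⟨α₁, hα₁⟩
  have hc01 : (⟨k₀, hkn⟩ : Fin n) ≠ ⟨u, hun⟩ := Fin.ne_of_val_ne (show k₀ ≠ u by omega)
  have hSdT : S \ T = A.erase v.1 := by rw [hS]; exact union_erase_sdiff_eq hh.1 hdisjC'
  have hTS : T ⊆ S ↔ v.1 ∈ A := by
    constructor
    · intro h
      have := h hh.1; rw [hS, Finset.mem_union] at this; exact this.resolve_right hpC'
    · intro h x hx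
      rw [hS, Finset.mem_union]
      by_cases hxv : x = v.1
      · exact Or.inl (hxv ▸ h)
      · exact Or.inr (Finset.mem_erase.mpr ⟨hxv, hx⟩)
  have hTφ : T.erase v.1 = C → (T = insert φ' C ↔ v.1 = φ') := fun hC => by
    constructor
    · intro h
      have : v.1 ∈ insert φ' C := h ▸ hh.1
      exact (Finset.mem_insert.mp this).resolve_right (hC ▸ hpC')
    · intro h
      rw [← h, ← hC, Finset.insert_erase hh.1]
  have hZ₂ : (univ.filter fun c : Fin n => k₀ + 1 ≤ (c : ℕ) ∧ (c : ℕ) < u).image π = A.erase α₁ := by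
    rw [permSlice_eq_sdiff π (by omega), ht3, ht2]
    ext x
    simp only [Finset.mem_sdiff, Finset.mem_insert, Finset.mem_union, Finset.mem_erase, not_or, ne_eq]
    constructor
    · rintro ⟨hx | hx | hx, hnφ, hnC⟩
      · exact absurd hx hnφ
      · exact absurd hx hnC
      · exact hx
    · rintro ⟨hx1, hxA⟩
      exact ⟨Or.inr (Or.inr ⟨hx1, hxA⟩), fun h => hφ'A (h ▸ hxA), fun h => Finset.disjoint_left.mp hdisjC hxA h⟩
  -- the evaluations
  have eX : eval (fun w : Fin n × Fin n => if π w.2 = w.1 ∨ (w.2 = (⟨k₀, hkn⟩ : Fin n) ∧ w.1 = π ⟨u, hun⟩) then (1 : k) else 0) (X v) = if (φ' = v.1 ∨ v.1 = α₁) then 1 else 0 := by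
    rw [eval_X, hv2]
    simp only [hπk, hπu, true_and]
  have eTS : eval (fun w : Fin n × Fin n => if π w.2 = w.1 ∨ (w.2 = (⟨k₀, hkn⟩ : Fin n) ∧ w.1 = π ⟨u, hun⟩) then (1 : k) else 0) ((1 - Grenet.adj k n).adjugate T S) = if v.1 = α₁ then 1 else 0 := by
    rw [evalPermExtra_grenet_W k π ⟨k₀, hkn⟩ ⟨u, hun⟩ hc01 T S (by rw [hTcard, hScard]; omega), hTcard, hScard, hZ₂]
    simp only [disjoint_and_union_eq_iff, hSdT, hπu, hπk]
    have n2 : ¬ (k₀ + 1 ≤ k₀ ∧ k₀ < u ∧ ¬ (k₀ + 1 ≤ u ∧ u < u) ∧ T ⊆ S ∧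
        A.erase v.1 = insert α₁ ((A.erase α₁).erase φ')) := fun h => by
      have := h.1; omega
    rw [if_neg n2, add_zero]
    by_cases hp : v.1 = α₁
    · rw [if_pos hp, if_pos ⟨hTS.mpr (hp ▸ hα₁), by rw [hp]⟩]
    · rw [if_neg hp, if_neg]
      rintro ⟨-, h⟩
      exact hp (((Finset.erase_inj A hα₁).mp h.symm).symm)
  have e0S : eval (fun w : Fin n × Fin n => if π w.2 = w.1 ∨ (w.2 = (⟨k₀, hkn⟩ : Fin n) ∧ w.1 = π ⟨u, hun⟩) then (1 : k) else 0) ((1 - Grenet.adj k n).adjugate ∅ S) = if T.erase v.1 = C then 1 else 0 := by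
    rw [evalPermExtra_grenet_W k π ⟨k₀, hkn⟩ ⟨u, hun⟩ hc01 ∅ S (by simp), Finset.card_empty, hScard,
      permSlice_zero, ht3, hπu, hπk]
    simp only [Finset.disjoint_empty_left, true_and, Finset.empty_union]
    have n1 : ¬ (insert φ' (C ∪ A.erase α₁) = S) := fun h => by
      have : α₁ ∈ S := by rw [hS]; exact Finset.mem_union_left _ hα₁
      rw [← h, Finset.mem_insert, Finset.mem_union] at this
      rcases this with h' | h' | h'
      · exact hφ'α h'.symm
      · exact hα₁C h'
      · exact Finset.notMem_erase _ _ h'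
    have hQ : insert α₁ ((insert φ' (C ∪ A.erase α₁)).erase φ') = A ∪ C := by
      ext x
      simp only [Finset.mem_insert, Finset.mem_erase, Finset.mem_union, ne_eq]
      constructor
      · rintro (rfl | ⟨hxφ, rfl | hxC | ⟨-, hxA⟩⟩)
        · exact Or.inl hα₁
        · exact absurd rfl hxφ
        · exact Or.inr hxC
        · exact Or.inl hxA
      · rintro (hxA | hxC)
        · by_cases hx1 : x = α₁
          · exact Or.inl hx1
          · exact Or.inr ⟨fun h => hφ'A (h ▸ hxA), Or.inr (Or.inr ⟨hx1, hxA⟩)⟩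
        · exact Or.inr ⟨fun h => hφ'C (h ▸ hxC), Or.inr (Or.inl hxC)⟩
    rw [hQ, if_neg n1, zero_add, hS]
    by_cases hC : T.erase v.1 = C
    · rw [if_pos hC, if_pos ⟨Nat.zero_le _, by omega, fun h => lt_irrefl _ h.2, by rw [hC]⟩]
    · rw [if_neg hC, if_neg]
      rintro ⟨-, -, -, h⟩
      exact hC ((union_eq_union_iff_of_disjoint hdisjC hdisjC').mp h).symm
  have eTU : eval (fun w : Fin n × Fin n => if π w.2 = w.1 ∨ (w.2 = (⟨k₀, hkn⟩ : Fin n) ∧ w.1 = π ⟨u, hun⟩) then (1 : k) else 0) ((1 - Grenet.adj k n).adjugate T univ) = if T = insert φ' C then 1 else 0 := by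
    rw [evalPermExtra_grenet_W k π ⟨k₀, hkn⟩ ⟨u, hun⟩ hc01 T univ (by rw [Finset.card_univ]; exact Finset.card_le_univ T),
      hTcard, Finset.card_univ, Fintype.card_fin, permSlice_to_top, ht2, hπu, hπk]
    have n2 : ¬ (k₀ + 1 ≤ k₀ ∧ k₀ < n ∧ ¬ (k₀ + 1 ≤ u ∧ u < n) ∧
        Disjoint T (insert α₁ (((insert φ' C)ᶜ).erase φ')) ∧ T ∪ insert α₁ (((insert φ' C)ᶜ).erase φ') = univ) :=
      fun h => by have := h.1; omega
    rw [if_neg n2, add_zero]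
    simp only [disjoint_compl_and_union_iff]
  rw [map_sub, map_mul, map_mul, map_mul, map_mul, evalExtra_perPoly k π _ _ hc01, eTS, eX, e0S, eTU]
  by_cases hp : v.1 = α₁
  · have hpφ : v.1 ≠ φ' := fun h => hφ'α (h.symm.trans hp)
    rw [if_pos hp, if_pos (Or.inr hp), if_neg (show ¬ (T.erase v.1 = C ∧ v.1 = φ') from fun h => hpφ h.2)]
    by_cases hC : T.erase v.1 = C
    · rw [if_pos hC, if_neg (show ¬ (T = insert φ' C) from fun h => hpφ ((hTφ hC).mp h))]; ring
    · rw [if_neg hC]; ring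
  · rw [if_neg hp]
    by_cases hφ : v.1 = φ'
    · rw [if_pos (Or.inl hφ.symm)]
      by_cases hC : T.erase v.1 = C
      · rw [if_pos hC, if_pos ((hTφ hC).mpr hφ), if_pos (show T.erase v.1 = C ∧ v.1 = φ' from ⟨hC, hφ⟩)]; ring
      · rw [if_neg hC, if_neg (show ¬ (T.erase v.1 = C ∧ v.1 = φ') from fun h => hC h.1)]; ring
    · rw [if_neg (show ¬ (φ' = v.1 ∨ v.1 = α₁) from fun h => h.elim (fun h' => hφ h'.symm) hp),
        if_neg (show ¬ (T.erase v.1 = C ∧ v.1 = φ') from fun h => hφ h.2)]; ring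

end Extra

end Summit.ValiantsHypothesis.Theorems.RigidityForcesSymmetry.GrenetGauge
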